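import Summits.CriticalPhenomena.PercolationContinuityZ3.Theses.PercSubharmonicSquare

/-!
# Crux `SubharmonicPower` (stmt-CriticalPhenomena-11505, route PercSubharmonicSquare): the split
# `DefectSubMeanValue → RingDispersion → SubharmonicPower` ("convexity amplification")

Strategist decomposition (BC2 redirect) of the deciding crux of route `PercSubharmonicSquare`.
The crux asks for ONE exponent `s > 0` and a box `Λ_R` such that `τ_p(0,·)^s` is nearest-neighbour
sub-mean-value at every `‖x‖ > R`, uniformly in `p < p_c(ℤ³)`.  It is split into two statements about
the connectivity itself (no power), on the six-point neighbour ring `N(x) = {x ± e_i}` of a far site `x`,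
with ring mean `m_p(x) = (1/6) Σ_{y ∈ N(x)} τ_p(0,y)`:

* `DefectSubMeanValue` — **sub-mean-value up to an `O(‖x‖⁻²)` defect**: `∃ A ≥ 0, R, ∀ p < p_c, ∀ ‖x‖ > R,
  τ_p(0,x) ≤ (1 + A/‖x‖²) · m_p(x)`.  World-neutral regularity: it holds for pure exponentials /
  plateau approaches (defect `≤ 1/(6‖x‖²)`) as well as for the critical power law `r^{-(1+η)}`, `η < 0`
  (defect `a(1-a)/(6 r²)`, `a = 1+η`), so it does not carry the conjunct; `s = 1` sub-mean-value itself
  (`A = 0`) is false near criticality (card MC: `σ₁(e₁) < 0` from `p ≈ 0.228`).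
* `RingDispersion` — **the ring is never flat**: `∃ B > 0, R, ∀ p < p_c, ∀ ‖x‖ > R,
  (1 + B/‖x‖²) · m_p(x)² ≤ (1/6) Σ_{y ∈ N(x)} τ_p(0,y)²`, i.e. the relative variance of `τ_p(0,·)` over
  the ring is at least `B/‖x‖²` (for a radial power law `r^{-a}` it is `a²/(3r²)`; in the
  Ornstein–Zernike regime it is of order one).  No sign / subharmonicity content.

**Assembly (this file, sorry-free).**  Raise to the power `q`: by `DefectSubMeanValue`,
`τ(x)^q ≤ (1 + A/r²)^q m^q ≤ (1 + 2qA/r²) m^q` once `r² ≥ 2qA`; by convexity of `t ↦ t^q` the ring mean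
of `τ^q` exceeds `m^q` by a variance gain.  Two regimes (normalised ring values `t_y = τ(y)/m`, mean `1`,
`S₂ = Σ (t_y - 1)² ≥ 6B/r²`): if `(q-1) S₂ ≥ 12 q A/r²` the GLOBAL bound `t^q ≥ 1 + q(t-1) + (q-1)(t-1)²`
(`t ≥ 0`) suffices; otherwise `S₂ < 24A/r² ≤ 1/(4q²)` (for `r² ≥ 96 q² A`), so every `|t_y - 1| ≤ 1/(2q)`
and the LOCAL bound `(1+u)^q ≥ 1 + qu + (1 - 1/(2q))^q · q(q-1)/2 · u² ≥ 1 + qu + q(q-1)/4 · u²` gives the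
gain `q(q-1) S₂/4 ≥ 12 q A/r²` as soon as `q - 1 ≥ 8A/B`.  Hence `SubharmonicPower` holds with
`s = q := ⌈8A/B⌉₊ + 2` and `R := max(R₁, R₂, 1, ⌈96 q² A⌉₊)`.  The exponent is thus fixed by the ratio
defect/dispersion (`A ≈ 0.007`, `B ≈ 0.3` at `p_c` give `q = 2`, the card's `SquareSubharmonic`).
-/

namespace Summit.CriticalPhenomena.PercolationContinuityZ3.Theorems

open Finset
open Literature.Probability.Percolation Literature.Probability.LatticeModels

namespace SubharmonicPowerSplit

/-! ## Elementary convexity inequalities for `t ↦ t^q` -/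

/-- Global second-order lower bound at `1`, all `t ≥ 0`:
`t^(n+1) ≥ 1 + (n+1)(t-1) + n (t-1)²` (induction; the defect is `n (t-1)² t ≥ 0`). [folklore] -/
theorem pow_succ_ge_taylor (t : ℝ) (ht : 0 ≤ t) :
    ∀ n : ℕ, 1 + ((n : ℝ) + 1) * (t - 1) + (n : ℝ) * (t - 1) ^ 2 ≤ t ^ (n + 1) := by
  intro n
  induction n with
  | zero => simp
  | succ n ih =>
    have hmul : (1 + ((n : ℝ) + 1) * (t - 1) + (n : ℝ) * (t - 1) ^ 2) * t ≤ t ^ (n + 1) * t :=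
      mul_le_mul_of_nonneg_right ih ht
    have hnn : 0 ≤ (n : ℝ) * (t - 1) ^ 2 * t :=
      mul_nonneg (mul_nonneg n.cast_nonneg (sq_nonneg _)) ht
    have hpow : t ^ (n + 1 + 1) = t ^ (n + 1) * t := pow_succ t (n + 1)
    rw [hpow]
    push_cast
    nlinarith [hmul, hnn]

/-- Local second-order lower bound: for `|u| ≤ δ ≤ 1`,
`(1+u)^n ≥ 1 + n u + (1-δ)^n · (n(n-1)/2) · u²`. [folklore] -/
theorem one_add_pow_ge_taylor_local (u δ : ℝ) (hδ1 : δ ≤ 1) (hu : |u| ≤ δ) :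
    ∀ n : ℕ, 1 + (n : ℝ) * u + (1 - δ) ^ n * ((n : ℝ) * ((n : ℝ) - 1) / 2) * u ^ 2 ≤ (1 + u) ^ n := by
  have hδ0 : 0 ≤ δ := (abs_nonneg u).trans hu
  have hu1 : 1 - δ ≤ 1 + u := by
    have := (abs_le.mp hu).1
    linarith
  have h1δ : 0 ≤ 1 - δ := by linarith
  have h1u : 0 ≤ 1 + u := h1δ.trans hu1
  intro n
  induction n with
  | zero => simp
  | succ n ih =>
    set c : ℝ := (n : ℝ) * ((n : ℝ) - 1) / 2 with hc
    have hc0 : 0 ≤ c := by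
      rcases Nat.eq_zero_or_pos n with h0 | hpos
      · simp [hc, h0]
      · have : (1 : ℝ) ≤ n := by exact_mod_cast hpos
        have : 0 ≤ (n : ℝ) - 1 := by linarith
        positivity
    have hpn : 0 ≤ (1 - δ) ^ n := pow_nonneg h1δ n
    have hpn1 : (1 - δ) ^ (n + 1) ≤ 1 := pow_le_one₀ h1δ (by linarith)
    have hmul : (1 + (n : ℝ) * u + (1 - δ) ^ n * c * u ^ 2) * (1 + u) ≤ (1 + u) ^ n * (1 + u) :=
      mul_le_mul_of_nonneg_right ih h1u
    have hquad : (1 - δ) ^ (n + 1) * c * u ^ 2 ≤ (1 - δ) ^ n * c * u ^ 2 * (1 + u) := by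
      have : (1 - δ) ^ (n + 1) * c * u ^ 2 = (1 - δ) ^ n * c * u ^ 2 * (1 - δ) := by ring
      rw [this]
      exact mul_le_mul_of_nonneg_left hu1 (mul_nonneg (mul_nonneg hpn hc0) (sq_nonneg u))
    have hlin : (1 - δ) ^ (n + 1) * (n : ℝ) * u ^ 2 ≤ (n : ℝ) * u ^ 2 := by
      have h0 : 0 ≤ (n : ℝ) * u ^ 2 := mul_nonneg n.cast_nonneg (sq_nonneg u)
      calc (1 - δ) ^ (n + 1) * (n : ℝ) * u ^ 2 = (1 - δ) ^ (n + 1) * ((n : ℝ) * u ^ 2) := by ring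
        _ ≤ 1 * ((n : ℝ) * u ^ 2) := mul_le_mul_of_nonneg_right hpn1 h0
        _ = (n : ℝ) * u ^ 2 := one_mul _
    have hcoef : ((n + 1 : ℕ) : ℝ) * (((n + 1 : ℕ) : ℝ) - 1) / 2 = c + n := by
      push_cast
      rw [hc]
      ring
    rw [hcoef]
    push_cast
    calc 1 + ((n : ℝ) + 1) * u + (1 - δ) ^ (n + 1) * (c + n) * u ^ 2
        = 1 + ((n : ℝ) + 1) * u + (1 - δ) ^ (n + 1) * c * u ^ 2
            + (1 - δ) ^ (n + 1) * (n : ℝ) * u ^ 2 := by ring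
      _ ≤ 1 + ((n : ℝ) + 1) * u + (1 - δ) ^ n * c * u ^ 2 * (1 + u) + (n : ℝ) * u ^ 2 := by
          linarith [hquad, hlin]
      _ = (1 + (n : ℝ) * u + (1 - δ) ^ n * c * u ^ 2) * (1 + u) := by ring
      _ ≤ (1 + u) ^ n * (1 + u) := hmul
      _ = (1 + u) ^ (n + 1) := (pow_succ (1 + u) n).symm

/-- `(1+a)^n ≤ 1 + 2 n a` for `a ≥ 0` with `2 n a ≤ 1`. [folklore] -/
theorem one_add_pow_le_linear (a : ℝ) (ha : 0 ≤ a) :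
    ∀ n : ℕ, 2 * (n : ℝ) * a ≤ 1 → (1 + a) ^ n ≤ 1 + 2 * (n : ℝ) * a := by
  intro n
  induction n with
  | zero => intro; simp
  | succ n ih =>
    intro h
    push_cast at h ⊢
    have hn : 2 * (n : ℝ) * a ≤ 1 := by nlinarith
    have hmul : (1 + a) ^ n * (1 + a) ≤ (1 + 2 * (n : ℝ) * a) * (1 + a) :=
      mul_le_mul_of_nonneg_right (ih hn) (by linarith)
    rw [pow_succ]
    nlinarith [hmul, mul_le_mul_of_nonneg_left hn ha]

/-- Bernoulli: `(1 - 1/(2q))^q ≥ 1/2` for `q ≥ 1`. [folklore] -/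
theorem half_le_pow (q : ℕ) (hq : 1 ≤ q) : (1 / 2 : ℝ) ≤ (1 - 1 / (2 * (q : ℝ))) ^ q := by
  have h := one_add_mul_le_pow (a := -(1 / (2 * (q : ℝ)))) (by
    have : 1 / (2 * (q : ℝ)) ≤ 1 / 2 :=
      one_div_le_one_div_of_le (by norm_num) (by
        have : (1 : ℝ) ≤ q := by exact_mod_cast hq
        linarith)
    linarith) q
  have hq' : (0 : ℝ) < q := by exact_mod_cast hq
  have : 1 + (q : ℝ) * -(1 / (2 * (q : ℝ))) = 1 / 2 := by
    field_simp
    ring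
  rw [this] at h
  simpa [sub_eq_add_neg] using h

/-! ## The core inequality on a finite family of non-negative numbers with mean one -/

/-- **Convexity amplification (core).** Let `t : ι → ℝ≥0` have mean `1` over a finite index set of
size `N`, squared deviation `S₂ = Σ (t_j - 1)²`, and let `a ≥ 0`, `q ≥ 2` with `2qa ≤ 1`,
`16 N q² a ≤ 1` and `8 a N ≤ (q-1) S₂`.  Then `N (1+a)^q ≤ Σ_j t_j^q`. [folklore] -/
theorem core {ι : Type*} [Fintype ι] (t : ι → ℝ) (ht : ∀ j, 0 ≤ t j)
    {N : ℝ} (hN : (Fintype.card ι : ℝ) = N)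
    (hmean : ∑ j, t j = N) {q : ℕ} (hq : 2 ≤ q) {a : ℝ} (ha : 0 ≤ a)
    (h1 : 2 * (q : ℝ) * a ≤ 1) (h2 : 16 * N * (q : ℝ) ^ 2 * a ≤ 1)
    (h3 : 8 * a * N ≤ ((q : ℝ) - 1) * ∑ j, (t j - 1) ^ 2) :
    (1 + a) ^ q * N ≤ ∑ j, t j ^ q := by
  set S2 := ∑ j, (t j - 1) ^ 2 with hS2
  have hN0 : 0 ≤ N := by rw [← hN]; exact Nat.cast_nonneg _
  have hS20 : 0 ≤ S2 := Finset.sum_nonneg fun j _ => sq_nonneg _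
  obtain ⟨n, rfl⟩ : ∃ n, q = n + 1 := ⟨q - 1, by omega⟩
  have hn1 : 1 ≤ n := by omega
  have hn1' : (1 : ℝ) ≤ n := by exact_mod_cast hn1
  push_cast at h1 h2 h3 ⊢
  have hq0 : (0 : ℝ) < (n : ℝ) + 1 := by positivity
  -- (E3): `(1+a)^q ≤ 1 + 2 q a`
  have hE3 : (1 + a) ^ (n + 1) ≤ 1 + 2 * ((n : ℝ) + 1) * a := by
    have := one_add_pow_le_linear a ha (n + 1) (by push_cast; exact h1)
    push_cast at this
    exact this
  -- the centred first moment vanishes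
  have hsum1 : ∑ j, (t j - 1) = 0 := by
    rw [Finset.sum_sub_distrib, hmean, Finset.sum_const, Finset.card_univ, hN.symm]
    simp
  by_cases hcase : 2 * ((n : ℝ) + 1) * a * N ≤ (n : ℝ) * S2
  · -- Regime A (large dispersion): the global bound summed over the ring
    have hsum : ∑ j, (1 + ((n : ℝ) + 1) * (t j - 1) + (n : ℝ) * (t j - 1) ^ 2)
        ≤ ∑ j, t j ^ (n + 1) :=
      Finset.sum_le_sum fun j _ => pow_succ_ge_taylor (t j) (ht j) n
    have hlhs : ∑ j, (1 + ((n : ℝ) + 1) * (t j - 1) + (n : ℝ) * (t j - 1) ^ 2)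
        = N + (n : ℝ) * S2 := by
      rw [Finset.sum_add_distrib, Finset.sum_add_distrib, Finset.sum_const, Finset.card_univ,
        ← Finset.mul_sum, ← Finset.mul_sum, hsum1, hS2]
      simp [hN.symm]
    rw [hlhs] at hsum
    calc (1 + a) ^ (n + 1) * N ≤ (1 + 2 * ((n : ℝ) + 1) * a) * N :=
          mul_le_mul_of_nonneg_right hE3 hN0
      _ = N + 2 * ((n : ℝ) + 1) * a * N := by ring
      _ ≤ N + (n : ℝ) * S2 := by linarith
      _ ≤ _ := hsum
  · -- Regime B (small dispersion): every deviation is `≤ 1/(2q)`, use the local bound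
    push Not at hcase
    have hS2small : S2 ≤ 4 * a * N := by
      -- `n S2 < 2(n+1) a N ≤ 4 n a N`
      have h4 : 2 * ((n : ℝ) + 1) * a * N ≤ 4 * (n : ℝ) * (a * N) := by
        have haN : 0 ≤ a * N := mul_nonneg ha hN0
        nlinarith
      have hn0 : (0 : ℝ) < n := by linarith
      have : (n : ℝ) * S2 ≤ (n : ℝ) * (4 * a * N) := by nlinarith
      exact le_of_mul_le_mul_left this hn0
    set δ : ℝ := 1 / (2 * ((n : ℝ) + 1)) with hδ
    have hδpos : 0 < δ := by rw [hδ]; positivity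
    have hδ1 : δ ≤ 1 := by
      rw [hδ, div_le_one (by positivity)]
      linarith
    have hdev : ∀ j, |t j - 1| ≤ δ := by
      intro j
      have hj : (t j - 1) ^ 2 ≤ S2 :=
        Finset.single_le_sum (f := fun k => (t k - 1) ^ 2) (fun k _ => sq_nonneg _)
          (Finset.mem_univ j)
      have hsq : (t j - 1) ^ 2 ≤ δ ^ 2 := by
        have : 4 * a * N ≤ δ ^ 2 := by
          rw [hδ, div_pow, one_pow, le_div_iff₀ (by positivity)]
          nlinarith
        linarith
      exact abs_le_of_sq_le_sq hsq hδpos.le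
    -- local bound with `(1-δ)^q ≥ 1/2`
    have hhalf : (1 / 2 : ℝ) ≤ (1 - δ) ^ (n + 1) := by
      have := half_le_pow (n + 1) (by omega)
      push_cast at this
      rw [hδ]
      exact this
    have hE2 : ∀ j, 1 + ((n : ℝ) + 1) * (t j - 1)
        + (1 / 2) * (((n : ℝ) + 1) * (n : ℝ) / 2) * (t j - 1) ^ 2 ≤ t j ^ (n + 1) := by
      intro j
      have h := one_add_pow_ge_taylor_local (t j - 1) δ hδ1 (hdev j) (n + 1)
      push_cast at h
      have hc0 : 0 ≤ (((n : ℝ) + 1) * ((n : ℝ) + 1 - 1) / 2) * (t j - 1) ^ 2 := by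
        have : ((n : ℝ) + 1 - 1) = n := by ring
        rw [this]
        positivity
      have hmono : (1 / 2) * ((((n : ℝ) + 1) * ((n : ℝ) + 1 - 1) / 2) * (t j - 1) ^ 2)
          ≤ (1 - δ) ^ (n + 1) * ((((n : ℝ) + 1) * ((n : ℝ) + 1 - 1) / 2) * (t j - 1) ^ 2) :=
        mul_le_mul_of_nonneg_right hhalf hc0
      have ht1 : 1 + (t j - 1) = t j := by ring
      rw [ht1] at h
      calc 1 + ((n : ℝ) + 1) * (t j - 1) + (1 / 2) * (((n : ℝ) + 1) * (n : ℝ) / 2) * (t j - 1) ^ 2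
          = 1 + ((n : ℝ) + 1) * (t j - 1)
            + (1 / 2) * ((((n : ℝ) + 1) * ((n : ℝ) + 1 - 1) / 2) * (t j - 1) ^ 2) := by ring
        _ ≤ 1 + ((n : ℝ) + 1) * (t j - 1)
            + (1 - δ) ^ (n + 1) * ((((n : ℝ) + 1) * ((n : ℝ) + 1 - 1) / 2) * (t j - 1) ^ 2) := by
            linarith
        _ = 1 + ((n : ℝ) + 1) * (t j - 1)
            + (1 - δ) ^ (n + 1) * (((n : ℝ) + 1) * ((n : ℝ) + 1 - 1) / 2) * (t j - 1) ^ 2 := by ring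
        _ ≤ t j ^ (n + 1) := h
    have hsum : ∑ j, (1 + ((n : ℝ) + 1) * (t j - 1)
        + (1 / 2) * (((n : ℝ) + 1) * (n : ℝ) / 2) * (t j - 1) ^ 2) ≤ ∑ j, t j ^ (n + 1) :=
      Finset.sum_le_sum fun j _ => hE2 j
    have hlhs : ∑ j, (1 + ((n : ℝ) + 1) * (t j - 1)
        + (1 / 2) * (((n : ℝ) + 1) * (n : ℝ) / 2) * (t j - 1) ^ 2)
        = N + (1 / 2) * (((n : ℝ) + 1) * (n : ℝ) / 2) * S2 := by
      rw [Finset.sum_add_distrib, Finset.sum_add_distrib, Finset.sum_const, Finset.card_univ,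
        ← Finset.mul_sum, ← Finset.mul_sum, hsum1, hS2]
      simp [hN.symm]
    rw [hlhs] at hsum
    -- gain `q(q-1) S₂ / 4 ≥ 2 q a N` from `8 a N ≤ (q-1) S₂`
    have hgain : 2 * ((n : ℝ) + 1) * a * N ≤ (1 / 2) * (((n : ℝ) + 1) * (n : ℝ) / 2) * S2 := by
      have h3' : 8 * a * N ≤ (n : ℝ) * S2 := by
        have : ((n : ℝ) + 1 - 1) = n := by ring
        rw [this] at h3
        exact h3
      nlinarith
    calc (1 + a) ^ (n + 1) * N ≤ (1 + 2 * ((n : ℝ) + 1) * a) * N :=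
          mul_le_mul_of_nonneg_right hE3 hN0
      _ = N + 2 * ((n : ℝ) + 1) * a * N := by ring
      _ ≤ N + (1 / 2) * (((n : ℝ) + 1) * (n : ℝ) / 2) * S2 := by linarith
      _ ≤ _ := hsum

/-! ## The split of the crux -/

/-- **`SubharmonicPower` from defect sub-mean-value and ring dispersion** (strategist split of the
deciding crux `stmt-CriticalPhenomena-11505` of route `PercSubharmonicSquare`; the two hypotheses are
the route's children `DefectSubMeanValue` and `RingDispersion`, written out).  With `A, R₁` from the
defect bound and `B, R₂` from the dispersion bound, `SubharmonicPower` holds with the natural exponent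
`s = q := ⌈8A/B⌉₊ + 2` and `R := max (max R₁ R₂) (max 1 ⌈96 q² A⌉₊)`: normalise the six ring values
by their mean and apply `core` (convexity amplification), then undo the normalisation. [folklore] -/
theorem subharmonicPower_of_defect_of_dispersion
    (hD : ∃ (A : ℝ) (R : ℕ), 0 ≤ A ∧ ∀ p : unitInterval,
      (p : ℝ) < criticalProb (zdGraph 3) (0 : Site 3) → ∀ x : Site 3, (R : ℝ) < ‖x‖ →
        tau 3 p 0 x ≤ (1 + A / ‖x‖ ^ 2) * ((1 / 6 : ℝ) * ∑ i : Fin 3,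
          (tau 3 p 0 (x + Pi.single i 1) + tau 3 p 0 (x - Pi.single i 1))))
    (hV : ∃ (B : ℝ) (R : ℕ), 0 < B ∧ ∀ p : unitInterval,
      (p : ℝ) < criticalProb (zdGraph 3) (0 : Site 3) → ∀ x : Site 3, (R : ℝ) < ‖x‖ →
        (1 + B / ‖x‖ ^ 2) * ((1 / 6 : ℝ) * ∑ i : Fin 3,
          (tau 3 p 0 (x + Pi.single i 1) + tau 3 p 0 (x - Pi.single i 1))) ^ 2 ≤
        (1 / 6 : ℝ) * ∑ i : Fin 3,
          (tau 3 p 0 (x + Pi.single i 1) ^ 2 + tau 3 p 0 (x - Pi.single i 1) ^ 2)) :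
    Summit.CriticalPhenomena.PercolationContinuityZ3.Theses.PercSubharmonicSquare.SubharmonicPower := by
  obtain ⟨A, R₁, hA, hdef⟩ := hD
  obtain ⟨B, R₂, hB, hdisp⟩ := hV
  -- the exponent `q = ⌈8A/B⌉₊ + 2` and the box `R`
  set q : ℕ := ⌈8 * A / B⌉₊ + 2 with hq
  have hq2 : 2 ≤ q := by rw [hq]; omega
  have hq1 : 8 * A / B ≤ (q : ℝ) - 1 := by
    have h := Nat.le_ceil (8 * A / B)
    rw [hq]
    push_cast
    linarith
  have hqpos : (0 : ℝ) < q := by exact_mod_cast (show 0 < q by omega)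
  set R : ℕ := max (max R₁ R₂) (max 1 ⌈96 * (q : ℝ) ^ 2 * A⌉₊) with hR
  refine ⟨(q : ℝ), R, hqpos, ?_⟩
  intro p hp x hx
  -- unpack `R < ‖x‖`
  rw [hR] at hx
  push_cast at hx
  simp only [max_lt_iff] at hx
  obtain ⟨⟨hx1, hx2⟩, hx3, hx4⟩ := hx
  set r : ℝ := ‖x‖ with hr
  have hr0 : 0 < r := by linarith
  have hr96 : 96 * (q : ℝ) ^ 2 * A ≤ r ^ 2 := by
    have h := Nat.le_ceil (96 * (q : ℝ) ^ 2 * A)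
    nlinarith
  -- real powers with a natural exponent are monoid powers
  simp only [Real.rpow_natCast]
  -- the six ring values and their mean
  set F : Fin 3 → ℝ := fun i => tau 3 p 0 (x + Pi.single i 1) with hF
  set G : Fin 3 → ℝ := fun i => tau 3 p 0 (x - Pi.single i 1) with hG
  have hF0 : ∀ i, 0 ≤ F i := fun i => tau_nonneg p 0 _
  have hG0 : ∀ i, 0 ≤ G i := fun i => tau_nonneg p 0 _
  set m : ℝ := (1 / 6 : ℝ) * ∑ i : Fin 3, (F i + G i) with hm
  have hm0 : 0 ≤ m := by
    rw [hm]
    exact mul_nonneg (by norm_num) (Finset.sum_nonneg fun i _ => add_nonneg (hF0 i) (hG0 i))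
  have hdef' : tau 3 p 0 x ≤ (1 + A / r ^ 2) * m := hdef p hp x hx1
  have hdisp' : (1 + B / r ^ 2) * m ^ 2 ≤ (1 / 6 : ℝ) * ∑ i : Fin 3, (F i ^ 2 + G i ^ 2) :=
    hdisp p hp x hx2
  have hτ0 : 0 ≤ tau 3 p 0 x := tau_nonneg p 0 x
  have ha : 0 ≤ A / r ^ 2 := by positivity
  show tau 3 p 0 x ^ q ≤ (1 / 6 : ℝ) * ∑ i : Fin 3, (F i ^ q + G i ^ q)
  have hrhs0 : 0 ≤ (1 / 6 : ℝ) * ∑ i : Fin 3, (F i ^ q + G i ^ q) :=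
    mul_nonneg (by norm_num)
      (Finset.sum_nonneg fun i _ => add_nonneg (pow_nonneg (hF0 i) q) (pow_nonneg (hG0 i) q))
  rcases hm0.eq_or_lt with hmz | hmpos
  · -- degenerate ring (`m = 0`, e.g. `p = 0`): then `τ(x) = 0`
    have hτz : tau 3 p 0 x = 0 := le_antisymm (by rw [← hmz, mul_zero] at hdef'; exact hdef') hτ0
    rw [hτz, zero_pow (by omega)]
    exact hrhs0
  -- normalised ring values `t = τ/m` on `Fin 3 ⊕ Fin 3`
  set t : Fin 3 ⊕ Fin 3 → ℝ := Sum.elim (fun i => F i / m) (fun i => G i / m) with ht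
  have ht0 : ∀ j, 0 ≤ t j := by
    rintro (i | i)
    · exact div_nonneg (hF0 i) hmpos.le
    · exact div_nonneg (hG0 i) hmpos.le
  have hN : (Fintype.card (Fin 3 ⊕ Fin 3) : ℝ) = 6 := by
    norm_num [Fintype.card_sum]
  have hsumFG : ∑ i : Fin 3, (F i + G i) = 6 * m := by
    rw [hm]
    ring
  have hmean : ∑ j, t j = 6 := by
    rw [Fintype.sum_sum_type]
    simp only [ht, Sum.elim_inl, Sum.elim_inr]
    rw [← Finset.sum_div, ← Finset.sum_div, ← add_div, ← Finset.sum_add_distrib, hsumFG]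
    field_simp
  have hsumsq : ∑ j, t j ^ 2 = (∑ i : Fin 3, (F i ^ 2 + G i ^ 2)) / m ^ 2 := by
    rw [Fintype.sum_sum_type]
    simp only [ht, Sum.elim_inl, Sum.elim_inr, div_pow]
    rw [← Finset.sum_div, ← Finset.sum_div, ← add_div, ← Finset.sum_add_distrib]
  have hsumq : ∑ j, t j ^ q = (∑ i : Fin 3, (F i ^ q + G i ^ q)) / m ^ q := by
    rw [Fintype.sum_sum_type]
    simp only [ht, Sum.elim_inl, Sum.elim_inr, div_pow]
    rw [← Finset.sum_div, ← Finset.sum_div, ← add_div, ← Finset.sum_add_distrib]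
  -- the dispersion hypothesis as a lower bound on the squared deviation
  have hS2 : 6 * (B / r ^ 2) ≤ ∑ j, (t j - 1) ^ 2 := by
    have hexp : ∑ j, (t j - 1) ^ 2 = ∑ j, t j ^ 2 - 2 * ∑ j, t j + 6 := by
      rw [Finset.mul_sum, ← Finset.sum_sub_distrib]
      have : ∑ j, (t j - 1) ^ 2 = ∑ j, ((t j ^ 2 - 2 * t j) + 1) :=
        Finset.sum_congr rfl fun j _ => by ring
      rw [this, Finset.sum_add_distrib, Finset.sum_const, Finset.card_univ]
      norm_num [Fintype.card_sum]
    have hsq6 : 6 * (1 + B / r ^ 2) ≤ ∑ j, t j ^ 2 := by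
      rw [hsumsq, le_div_iff₀ (by positivity)]
      nlinarith [hdisp']
    rw [hexp, hmean]
    linarith
  -- hypotheses of `core` with `a = A/r²`, `N = 6`
  have h1 : 2 * (q : ℝ) * (A / r ^ 2) ≤ 1 := by
    rw [show 2 * (q : ℝ) * (A / r ^ 2) = (2 * (q : ℝ) * A) / r ^ 2 by ring,
      div_le_one (by positivity)]
    have hq2' : (2 : ℝ) ≤ q := by exact_mod_cast hq2
    have : (2 : ℝ) * q ≤ 96 * (q : ℝ) ^ 2 := by nlinarith
    nlinarith
  have h2 : 16 * 6 * (q : ℝ) ^ 2 * (A / r ^ 2) ≤ 1 := by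
    rw [show 16 * 6 * (q : ℝ) ^ 2 * (A / r ^ 2) = (96 * (q : ℝ) ^ 2 * A) / r ^ 2 by ring,
      div_le_one (by positivity)]
    exact hr96
  have h3 : 8 * (A / r ^ 2) * 6 ≤ ((q : ℝ) - 1) * ∑ j, (t j - 1) ^ 2 := by
    have hq1' : 8 * A ≤ ((q : ℝ) - 1) * B := by
      have := (div_le_iff₀ hB).mp hq1
      linarith
    have hqm : 0 ≤ (q : ℝ) - 1 := by
      have : (2 : ℝ) ≤ q := by exact_mod_cast hq2
      linarith
    calc 8 * (A / r ^ 2) * 6 = (8 * A) * (6 / r ^ 2) := by ring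
      _ ≤ (((q : ℝ) - 1) * B) * (6 / r ^ 2) :=
          mul_le_mul_of_nonneg_right hq1' (by positivity)
      _ = ((q : ℝ) - 1) * (6 * (B / r ^ 2)) := by ring
      _ ≤ ((q : ℝ) - 1) * ∑ j, (t j - 1) ^ 2 := mul_le_mul_of_nonneg_left hS2 hqm
  have hcore := core t ht0 hN hmean hq2 ha h1 h2 h3
  -- undo the normalisation
  rw [hsumq, le_div_iff₀ (pow_pos hmpos q)] at hcore
  have hmq : 0 ≤ m ^ q := pow_nonneg hmpos.le q
  calc tau 3 p 0 x ^ q ≤ ((1 + A / r ^ 2) * m) ^ q := pow_le_pow_left₀ hτ0 hdef' q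
    _ = (1 + A / r ^ 2) ^ q * m ^ q := mul_pow _ _ _
    _ = ((1 + A / r ^ 2) ^ q * 6 * m ^ q) * (1 / 6) := by ring
    _ ≤ (∑ i : Fin 3, (F i ^ q + G i ^ q)) * (1 / 6) :=
        mul_le_mul_of_nonneg_right hcore (by norm_num)
    _ = (1 / 6 : ℝ) * ∑ i : Fin 3, (F i ^ q + G i ^ q) := by ring

end SubharmonicPowerSplit

end Summit.CriticalPhenomena.PercolationContinuityZ3.Theorems
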